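import Mathlib
import Summits.Ventures.HodgeRepro2.T5SemisimpleQuotient

/-!
# `dim End ≤ 1` ⟺ every endomorphism is a scalar; hence `θ(π)` is `0` or irreducible

Blind cell `pub-hodge-repro2`, seat p8 (gen 6), Tier-5 kernel support for the N3 record
(§N3.11.4 (r1)/(r3): Gan–Takeda's Howe duality (HD) at `π′ = π` reads
`dim_ℂ Hom_{H(V)}(θ(π), θ(π)) ≤ 1`; CHECK-N3 §8).  `T5SemisimpleQuotient` (p391357) proved that a
semisimple module ALL OF WHOSE endomorphisms are scalars is `0` or simple; the printed input is
the DIMENSION bound.  This file records the one-line bridge: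

* `exists_smul_eq_of_rank_le_one` — if the `k`-vector space `End_R(M)` has rank `≤ 1` and
  `M ≠ 0`, every `R`-endomorphism of `M` is a `k`-scalar (`id ≠ 0` spans);
* `rank_le_one_iff_forall_exists_smul_eq` — the converse too;
* `isSimpleModule_or_subsingleton_of_rank_le_one` — **(HD) at `π′ = π` ⇒ `θ(π)` is `0` or
  irreducible** for semisimple `θ(π)` (composition with p391357).

What stays prose: (HD) itself (Gan–Takeda Thm 1.2, printed) and the identification of its
`Hom` space with `End_R(M)`.  Nothing arithmetic is asserted.

README §8(d): uses an L-value-free non-vanishing device: NO.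
-/

namespace Summit.Ventures.HodgeRepro2.T5EndRankOne

open Summit.Ventures.HodgeRepro2

section Rank

variable {k R M : Type*} [Field k] [Ring R] [AddCommGroup M] [Module R M] [Module k M]
  [SMulCommClass R k M]

/-- **`rank_k End_R(M) ≤ 1 ⇒ scalars.`** For `M ≠ 0`, if the `k`-vector space of
`R`-endomorphisms of `M` has rank at most `1`, every endomorphism is a `k`-scalar
(`LinearMap.id ≠ 0` is then a spanning vector). -/
theorem exists_smul_eq_of_rank_le_one [Nontrivial M]
    (h : Module.rank k (M →ₗ[R] M) ≤ 1) (φ : M →ₗ[R] M) : ∃ c : k, ∀ x, φ x = c • x := by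
  obtain ⟨v₀, hv₀⟩ := rank_le_one_iff.mp h
  obtain ⟨r₀, hr₀⟩ := hv₀ LinearMap.id
  have hr₀ne : r₀ ≠ 0 := by
    intro h0
    rw [h0, zero_smul] at hr₀
    obtain ⟨x, hx⟩ := exists_ne (0 : M)
    apply hx
    have := LinearMap.congr_fun hr₀ x
    simpa using this.symm
  obtain ⟨r, hr⟩ := hv₀ φ
  refine ⟨r * r₀⁻¹, fun x => ?_⟩
  have hv : v₀ = r₀⁻¹ • LinearMap.id := by
    rw [← hr₀, smul_smul, inv_mul_cancel₀ hr₀ne, one_smul]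
  rw [← hr, hv, smul_smul, LinearMap.smul_apply, LinearMap.id_apply]

/-- The converse: if every endomorphism is a scalar, `rank_k End_R(M) ≤ 1`. -/
theorem rank_le_one_of_forall_exists_smul_eq
    (h : ∀ φ : M →ₗ[R] M, ∃ c : k, ∀ x, φ x = c • x) : Module.rank k (M →ₗ[R] M) ≤ 1 := by
  refine rank_le_one_iff.mpr ⟨LinearMap.id, fun φ => ?_⟩
  obtain ⟨c, hc⟩ := h φ
  exact ⟨c, LinearMap.ext fun x => by rw [LinearMap.smul_apply, LinearMap.id_apply, hc x]⟩

/-- `rank_k End_R(M) ≤ 1 ⟺ every endomorphism is a scalar` (`M ≠ 0`). -/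
theorem rank_le_one_iff_forall_exists_smul_eq [Nontrivial M] :
    Module.rank k (M →ₗ[R] M) ≤ 1 ↔ ∀ φ : M →ₗ[R] M, ∃ c : k, ∀ x, φ x = c • x :=
  ⟨exists_smul_eq_of_rank_le_one, rank_le_one_of_forall_exists_smul_eq⟩

end Rank

section Theta

variable {k R M : Type*} [Field k] [Ring R] [AddCommGroup M] [Module R M] [Module k M]
  [SMulCommClass R k M]

/-- **(HD) at `π′ = π` ⇒ `θ(π)` is `0` or irreducible.** A semisimple module whose
`k`-vector space of `R`-endomorphisms has rank `≤ 1` is `0` or simple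
(`T5SemisimpleQuotient.isSimpleModule_or_subsingleton_of_endo_scalar`). -/
theorem isSimpleModule_or_subsingleton_of_rank_le_one [IsSemisimpleModule R M]
    (h : Module.rank k (M →ₗ[R] M) ≤ 1) : IsSimpleModule R M ∨ Subsingleton M := by
  rcases subsingleton_or_nontrivial M with hM | hM
  · exact Or.inr hM
  · exact T5SemisimpleQuotient.isSimpleModule_or_subsingleton_of_endo_scalar
      (exists_smul_eq_of_rank_le_one h)

/-- The same with `finrank` (`finrank ≤ 1` implies `rank ≤ 1` when `End_R(M)` is
finite-dimensional). -/
theorem isSimpleModule_or_subsingleton_of_finrank_le_one [IsSemisimpleModule R M]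
    [Module.Finite k (M →ₗ[R] M)] (h : Module.finrank k (M →ₗ[R] M) ≤ 1) :
    IsSimpleModule R M ∨ Subsingleton M := by
  apply isSimpleModule_or_subsingleton_of_rank_le_one (k := k)
  rw [← Module.finrank_eq_rank k (M →ₗ[R] M)]
  exact_mod_cast h

end Theta

end Summit.Ventures.HodgeRepro2.T5EndRankOne
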